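import Summits.CriticalPhenomena.PercolationContinuityZ3.Theorems.PercTorusSliceFillingTorusNonProliferationBK
import Summits.CriticalPhenomena.PercolationContinuityZ3.Theorems.PercTorusSliceFillingThinClusterTransportGlue
import HarnessLib

/-!
# `TorusNonProliferation`: the BK reduction at block length `M₀` (route `PercTorusSliceFilling`,
# crux stmt-CriticalPhenomena-5415)

Support file (`--supports stmt-CriticalPhenomena-5415`), written by the line lead (c4) of crux
`TorusNonProliferation` (tightness of the number `N_sf(T_n)` of slice-filling (sf) open clusters
of the critical 3-torus `T_n = (ℤ/nℤ)³`; `S` is sf iff `∃ i, ∀ t : ZMod n, ∃ y ∈ S, y i = t`).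

Write `E = {some open cluster of T_n is sf}` (increasing) and `E □^m = disjointOccurrencePow E m`
("`m` pairwise disjoint open witnesses of `E`", i.e. `m` edge-disjoint open subgraphs each having
a slice-filling connected component). The landed file `PercTorusSliceFillingTorusNonProliferationBK`
proves `{N_sf ≥ k} ⊆ E □^k` and hence the crux from `inf_n P_{p_c}(Eᶜ) > 0` (block length `1`).
Here the block length is arbitrary:

* `setOf_mul_le_numSliceFilling_subset` — `{N_sf ≥ k·M₀} ⊆ (E □^{M₀}) □^k`: group `k·M₀`
  distinct sf clusters into `k` blocks of `M₀`; the union of the open-edge witnesses of a block is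
  an open witness of `E □^{M₀}`, and different blocks give disjoint witnesses.
* `real_mul_le_numSliceFilling_le_pow` — hence, by the iterated van den Berg–Kesten inequality
  applied to the increasing local event `E □^{M₀}`, `P_p(N_sf ≥ k·M₀) ≤ P_p(E □^{M₀})^k` at every
  `p` and every `n ≥ 1`.
* `torusNonProliferation_of_sfWitnesses_eventually_bounded` — the crux follows from
  `∃ M₀, liminf_n P_{T_n,p_c}((E □^{M₀})ᶜ) > 0`, i.e. from: for SOME fixed `M₀`, with probability
  bounded away from zero the critical torus does NOT carry `M₀` edge-disjoint slice-filling open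
  structures. For `M₀ = 1` this is the landed hypothesis "no sf cluster with probability `≥ c`"
  (the torus form of the hard direction of the Borgs–Chayes–Kesten–Spencer crossing postulate);
  the hypotheses get WEAKER as `M₀` grows, and this is the weakest input from which the BK
  mechanism yields tightness. None of them is proved here (open in `d = 3`, false for `d ≥ 7`).
-/

noncomputable section

namespace Summit.CriticalPhenomena.PercolationContinuityZ3.Theorems

open MeasureTheory Set
open Literature.Probability.Percolation Literature.Probability.LatticeModels
open scoped Literature.Probability.Percolation

namespace PercTorusSliceFillingTorusNonProliferationBKPow

open PercTorusSliceFillingTorusNonProliferationBK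

/-- **`{N_sf ≥ k·M₀} ⊆ (E □^{M₀}) □^k`** for `E = {some open cluster is slice-filling}`: `k·M₀`
distinct slice-filling clusters, grouped into `k` blocks of `M₀`, carry `k` pairwise disjoint open
witnesses of `E □^{M₀}` (each block witness is the union of the open-edge witnesses
`{e ∈ ω | both endpoints in C(x_j)}` of its `M₀` clusters). [folklore] -/
theorem setOf_mul_le_numSliceFilling_subset (n : ℕ) [NeZero n] (M₀ k : ℕ) :
    {ω : BondConfig (TorusSite 3 n) | k * M₀ ≤ Set.ncard {S : Set (TorusSite 3 n) |
        (∃ x, S = openCluster ω x) ∧ ∃ i : Fin 3, ∀ t : ZMod n, ∃ y ∈ S, y i = t}} ⊆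
      disjointOccurrencePow (disjointOccurrencePow
        {ω : BondConfig (TorusSite 3 n) | ∃ x : TorusSite 3 n, ∃ i : Fin 3, ∀ t : ZMod n,
          ∃ y ∈ openCluster ω x, y i = t} M₀) k := by
  classical
  intro ω hω
  rw [Set.mem_setOf_eq] at hω
  set 𝒮 : Set (Set (TorusSite 3 n)) := {S : Set (TorusSite 3 n) |
      (∃ x, S = openCluster ω x) ∧ ∃ i : Fin 3, ∀ t : ZMod n, ∃ y ∈ S, y i = t} with h𝒮
  have hfin : 𝒮.Finite := Set.toFinite 𝒮
  letI : Fintype ↥𝒮 := hfin.fintype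
  have hcard : k * M₀ ≤ Fintype.card ↥𝒮 := by
    rwa [← Nat.card_eq_fintype_card, Nat.card_coe_set_eq]
  -- `k·M₀` distinct slice-filling clusters, indexed by pairs `(block, position)`
  let ι : Fin k × Fin M₀ ↪ ↥𝒮 :=
    (finProdFinEquiv.toEmbedding.trans (Fin.castLEEmb hcard)).trans
      (Fintype.equivFin _).symm.toEmbedding
  have hrep : ∀ j : Fin k × Fin M₀, ∃ x : TorusSite 3 n,
      ((ι j : Set (TorusSite 3 n)) = openCluster ω x) := fun j => (ι j).2.1
  choose x hx using hrep
  have hsf : ∀ j : Fin k × Fin M₀, ∃ i : Fin 3, ∀ t : ZMod n, ∃ y ∈ openCluster ω (x j), y i = t :=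
    fun j => by rw [← hx j]; exact (ι j).2.2
  have hne : ∀ j j' : Fin k × Fin M₀, j ≠ j' → openCluster ω (x j) ≠ openCluster ω (x j') := by
    intro j j' hjj' heq
    exact hjj' (ι.injective (Subtype.ext (by rw [hx j, hx j', heq])))
  -- the open-edge witness of the cluster of `x j`
  set W : Fin k × Fin M₀ → BondConfig (TorusSite 3 n) :=
    fun j => {e | e ∈ ω ∧ ∀ v ∈ e, (openGraph ω).Reachable (x j) v} with hW
  have hWE : ∀ j, W j ∈ {ω : BondConfig (TorusSite 3 n) | ∃ x : TorusSite 3 n, ∃ i : Fin 3,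
      ∀ t : ZMod n, ∃ y ∈ openCluster ω x, y i = t} := by
    intro j
    obtain ⟨i, hi⟩ := hsf j
    refine ⟨x j, i, fun t => ?_⟩
    obtain ⟨y, hy, hyt⟩ := hi t
    exact ⟨y, openCluster_subset_openCluster_clusterEdges ω (x j) hy, hyt⟩
  have hWdisj : ∀ j j', j ≠ j' → Disjoint (W j) (W j') :=
    fun j j' hjj' => disjoint_clusterEdges (hne j j' hjj')
  have hE : IsUpperSet {ω : BondConfig (TorusSite 3 n) | ∃ x : TorusSite 3 n, ∃ i : Fin 3,
      ∀ t : ZMod n, ∃ y ∈ openCluster ω x, y i = t} := isUpperSet_sfEvent n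
  -- block witnesses
  refine mem_disjointOccurrencePow_of_pairwise_disjoint (hE.disjointOccurrencePow M₀)
    (fun g => ⋃ m : Fin M₀, W (g, m))
    (fun g => Set.iUnion_subset fun m => clusterEdges_subset ω (x (g, m)))
    (fun g => ?_) (fun g g' hgg' => ?_)
  · -- each block witness lies in `E □^{M₀}`
    exact mem_disjointOccurrencePow_of_pairwise_disjoint hE (fun m => W (g, m))
      (fun m => Set.subset_iUnion (fun m : Fin M₀ => W (g, m)) m) (fun m => hWE (g, m))
      fun m m' hmm' => hWdisj (g, m) (g, m') fun h => hmm' (Prod.ext_iff.1 h).2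
  · -- different blocks give disjoint witnesses
    show Disjoint (⋃ m : Fin M₀, W (g, m)) (⋃ m : Fin M₀, W (g', m))
    rw [Set.disjoint_iUnion_left]
    intro m
    rw [Set.disjoint_iUnion_right]
    intro m'
    exact hWdisj (g, m) (g', m') fun h => hgg' (Prod.ext_iff.1 h).1

end PercTorusSliceFillingTorusNonProliferationBKPow

open PercTorusSliceFillingTorusNonProliferationBK PercTorusSliceFillingTorusNonProliferationBKPow

/-- **Geometric tail of `N_sf` in blocks of `M₀` (every `p`, every `n ≥ 1`).** On the torus
`T_n`, `P_p(N_sf ≥ k·M₀) ≤ P_p(E □^{M₀})^k` where `E = {some open cluster is slice-filling}` and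
`E □^{M₀} = disjointOccurrencePow E M₀`: the inclusion `setOf_mul_le_numSliceFilling_subset` and
the iterated van den Berg–Kesten inequality `measureReal_disjointOccurrencePow_le` for the local
increasing event `E □^{M₀}` (Grimmett 1999 Thm 2.12 / (2.14)). [folklore] -/
theorem real_mul_le_numSliceFilling_le_pow (p : unitInterval) (n : ℕ) (hn : 1 ≤ n) (M₀ k : ℕ) :
    (bondPercolation (torusGraph 3 n) p).real {ω | k * M₀ ≤ Set.ncard {S : Set (TorusSite 3 n) |
        (∃ x, S = openCluster ω x) ∧ ∃ i : Fin 3, ∀ t : ZMod n, ∃ y ∈ S, y i = t}} ≤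
      ((bondPercolation (torusGraph 3 n) p).real (disjointOccurrencePow
        {ω : BondConfig (TorusSite 3 n) | ∃ x : TorusSite 3 n, ∃ i : Fin 3, ∀ t : ZMod n,
          ∃ y ∈ openCluster ω x, y i = t} M₀)) ^ k := by
  haveI : NeZero n := ⟨by omega⟩
  calc (bondPercolation (torusGraph 3 n) p).real {ω | k * M₀ ≤ Set.ncard {S : Set (TorusSite 3 n) |
          (∃ x, S = openCluster ω x) ∧ ∃ i : Fin 3, ∀ t : ZMod n, ∃ y ∈ S, y i = t}}
      ≤ (bondPercolation (torusGraph 3 n) p).real (disjointOccurrencePow (disjointOccurrencePow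
          {ω : BondConfig (TorusSite 3 n) | ∃ x : TorusSite 3 n, ∃ i : Fin 3, ∀ t : ZMod n,
            ∃ y ∈ openCluster ω x, y i = t} M₀) k) :=
        measureReal_mono (setOf_mul_le_numSliceFilling_subset n M₀ k)
    _ ≤ ((bondPercolation (torusGraph 3 n) p).real (disjointOccurrencePow
          {ω : BondConfig (TorusSite 3 n) | ∃ x : TorusSite 3 n, ∃ i : Fin 3, ∀ t : ZMod n,
            ∃ y ∈ openCluster ω x, y i = t} M₀)) ^ k :=
        measureReal_disjointOccurrencePow_le (torusGraph 3 n) p (isLocalEvent_of_torus n _) k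

/-- **BK reduction of the crux `TorusNonProliferation` at block length `M₀` (the weakest BK-type
sufficient input).** Suppose that for SOME `M₀` the critical 3-torus carries `M₀` edge-disjoint
slice-filling open structures only with probability bounded away from one, eventually in `n`:
`∃ M₀, ∃ c > 0, ∃ N, ∀ n ≥ N, P_{T_n,p_c}((E □^{M₀})ᶜ) ≥ c` (NOT proved; for `M₀ = 1` it is the
torus form of "critical crossing probabilities stay bounded away from one", open in `d = 3`,
false for `d ≥ 7`). Then the number of slice-filling clusters is tight: for `n ≥ N`,
`P(N_sf ≥ k·M₀) ≤ (1 - c)^k` by `real_mul_le_numSliceFilling_le_pow`, and tori `3 ≤ n < N` carry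
at most `n³ < N³` slice-filling clusters (landed `ncard_sliceFilling_le`). [folklore] -/
theorem torusNonProliferation_of_sfWitnesses_eventually_bounded :
    (∃ M₀ : ℕ, ∃ c : ℝ, 0 < c ∧ ∃ N : ℕ, ∀ n : ℕ, N ≤ n →
      c ≤ (Literature.Probability.Percolation.bondPercolation
        (Literature.Probability.LatticeModels.torusGraph 3 n)
        (Literature.Probability.Percolation.criticalProbI 3)).real
        (Literature.Probability.Percolation.disjointOccurrencePow
          {ω : Literature.Probability.Percolation.BondConfig
              (Literature.Probability.LatticeModels.TorusSite 3 n) |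
            ∃ x : Literature.Probability.LatticeModels.TorusSite 3 n, ∃ i : Fin 3, ∀ t : ZMod n,
              ∃ y ∈ Literature.Probability.Percolation.openCluster ω x, y i = t} M₀)ᶜ) →
    Summit.CriticalPhenomena.PercolationContinuityZ3.Theses.PercTorusSliceFilling.TorusNonProliferation := by
  classical
  rintro ⟨M₀, c, hc, N, hN⟩
  unfold Summit.CriticalPhenomena.PercolationContinuityZ3.Theses.PercTorusSliceFilling.TorusNonProliferation
  intro δ hδ
  -- `c ≤ 1`: it is bounded by a probability (use `n = N`)
  have hc1 : c ≤ 1 := (hN N le_rfl).trans measureReal_le_one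
  obtain ⟨k, hk⟩ := exists_pow_lt_of_lt_one hδ (show 1 - c < 1 by linarith)
  -- the level: `M := k·M₀ + N³` dominates both regimes
  refine ⟨k * M₀ + N ^ 3, fun n hn => ?_⟩
  haveI : NeZero n := ⟨by omega⟩
  set μ := bondPercolation (torusGraph 3 n) (criticalProbI 3) with hμ
  by_cases hnN : N ≤ n
  · -- large tori: BK at block length `M₀`
    set F : Set (BondConfig (TorusSite 3 n)) := disjointOccurrencePow
        {ω : BondConfig (TorusSite 3 n) | ∃ x : TorusSite 3 n, ∃ i : Fin 3, ∀ t : ZMod n,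
          ∃ y ∈ openCluster ω x, y i = t} M₀ with hFdef
    have hF : μ.real F ≤ 1 - c := by
      have hmeas : MeasurableSet F := (Set.toFinite _).measurableSet
      have hcompl : μ.real F + μ.real Fᶜ = 1 := probReal_add_probReal_compl hmeas
      have hc' : c ≤ μ.real Fᶜ := hN n hnN
      linarith
    calc μ.real {ω | k * M₀ + N ^ 3 ≤ Set.ncard {S : Set (TorusSite 3 n) |
            (∃ x, S = openCluster ω x) ∧ ∃ i : Fin 3, ∀ t : ZMod n, ∃ y ∈ S, y i = t}}
        ≤ μ.real {ω | k * M₀ ≤ Set.ncard {S : Set (TorusSite 3 n) |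
            (∃ x, S = openCluster ω x) ∧ ∃ i : Fin 3, ∀ t : ZMod n, ∃ y ∈ S, y i = t}} := by
          refine measureReal_mono fun ω hω => ?_
          exact le_trans (Nat.le_add_right _ _) hω
      _ ≤ (μ.real F) ^ k := real_mul_le_numSliceFilling_le_pow (criticalProbI 3) n (by omega) M₀ k
      _ ≤ (1 - c) ^ k := pow_le_pow_left₀ measureReal_nonneg hF k
      _ ≤ δ := hk.le
  · -- small tori `3 ≤ n < N`: at most `n³ < N³` slice-filling clusters, the event is empty
    have hlt : n < N := Nat.lt_of_not_le hnN
    have hsub0 : {ω : BondConfig (TorusSite 3 n) | k * M₀ + N ^ 3 ≤ Set.ncard {S : Set (TorusSite 3 n) |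
        (∃ x, S = openCluster ω x) ∧ ∃ i : Fin 3, ∀ t : ZMod n, ∃ y ∈ S, y i = t}} ⊆ ∅ := by
      intro ω hω
      have h1 := PercTorusSliceFillingThinClusterTransport.ncard_sliceFilling_le n ω
      have h2 : n ^ 3 < N ^ 3 := Nat.pow_lt_pow_left hlt three_ne_zero
      have h3 : k * M₀ + N ^ 3 ≤ n ^ 3 := le_trans hω h1
      omega
    calc μ.real {ω | k * M₀ + N ^ 3 ≤ Set.ncard {S : Set (TorusSite 3 n) |
            (∃ x, S = openCluster ω x) ∧ ∃ i : Fin 3, ∀ t : ZMod n, ∃ y ∈ S, y i = t}}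
        ≤ μ.real (∅ : Set _) := measureReal_mono hsub0
      _ = 0 := measureReal_empty
      _ ≤ δ := hδ.le

end Summit.CriticalPhenomena.PercolationContinuityZ3.Theorems

end
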